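import Literature.MathematicalPhysics.QuantumFieldTheory.Balaban1983to89.B8Prop5GaugeParamKLevel
import Literature.MathematicalPhysics.QuantumFieldTheory.Balaban1983to89.B8Prop5KLevelLetters
import Literature.MathematicalPhysics.QuantumFieldTheory.Balaban1983to89.B8Restr129Inversion
import Literature.MathematicalPhysics.QuantumFieldTheory.Balaban1983to89.B8Eq195Linear

/-!
# `Balaban1983to89.B8Prop5JoinHFP` — T. Bałaban, *Spaces of regular gauge field configurations on a lattice and gauge fixing conditions*,
# Commun. Math. Phys. **99** (1985) 75–102 [Balaban1985RegularSpaces] ("B8"), Sect. D–E pp. 92–96: PROPOSITION 5'S FIXED POINT HANDED TO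
# THE THEOREM-4 KNIT («JOIN-B») — from the contraction's fixed point (`B8Prop5GaugeParamKLevel.gaugeParam_kLevel`, p429304) with the
# letter `R = I − G′Q′*CQ′G′` of (1.95) (`B8Eq195Linear`), the projection laws give `Q′λ = 0` and the MULTIPLIER FORM of the Landau equation
# (`B8Prop5KLevelLetters.multiplier_iff_of_whyZ`, `pub-ymgap-dag-n04-b`), and Sect. E's (1.114) for the inverse pair with the ORDER ruling
# (a″) (`B8Restr129Inversion.restr129_mul_of_cond179_inv`) gives (1.29) for the composite `u₁·e^{iλ′}` — i.e. the binder `hFP` of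
# `B8Prop5KLevelLetters.hP5_step_of_HFP` / the socket `B8LeafModelZdOfHFP.SockHFP`, modulo the displayed letters and Sect. E inputs

statement-level skeleton of published theorems with citation tags; proofs where landed; nothing here is a claim about the
Yang–Mills mass gap

PDF held: `paper:balaban1985-cmp99-regular-spaces-gauge-fixing` (journal page = PDF page + 74); pp. 92–96.

WHY THIS FILE (cell `pub-ymgap`, HUMAN RULING D-0062, REBALANCE №41-b; seat `pub-ymgap-dag-n19-b` g2; the last file of the CUT-3 assembly on
the №41-b side).  INPUTS BY NAME: JOIN-A `gaugeParam_kLevel` (fixed point `s`, gauge parameter `s′`, `λ′ = λ + H_cλ`, (1.108), Hermitian,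
support, Neumann identity); `B8Eq195Linear.eq_g_proj325_iff` (`λ = G′RY ⇔ Q′λ = 0 ∧ Δλ = RY`), `.proj325_sub`; `pub-ymgap-dag-n04-b`'s
`B8Prop5KLevelLetters.multiplier_iff_of_whyZ` (the HFP multiplier clause ⇔ the multiplier form of `Z − RZ`), `.covLap_sub`, `.gAd_sub`,
`B8Eq188Proof.gAd_neg`, `B8Eq138LandauZd.covLap_zero`; `B8Restr129Inversion.restr129_mul_of_cond179_inv` ((a″): (1.29) for `u₁·u′` from
`Cond179` of the inverse pair).  DISPLAYED: the letters `G′ = g`, `C = c`, `Q′ = q`, `Q′ᵀ = qs`, the weights `a = Aw`, the Dirichlet Laplacian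
`Δ` as ℂ-linear maps with three of the four projection laws of [4] (`g_left`, `g_right`, `c_right`) and their concrete readings on `Ω₀` (`hΔ`, `hqs`); the (1.98)-type bounds of `G′` and
`R`; the Sect. E correction `H_c` with its sizes/moduli (JOIN-A); Sect. E's (1.114) identity `h114` and the (167)/domain inputs of the inverse
pair ([3] Prop. 10) on the ball; (1.29) for `u₁⁻¹`.

WHAT THIS FILE PROVES (kernel, 0 sorry, theorems only; `𝔸` a nontrivial C⋆-algebra): `covLap_neg'` (bookkeeping) and
**`hFP_kLevel`** — ∃ `λ′ : Site d → 𝔸`, Hermitian, `= 0` off `Ω₀`, (1.108) on the bonds `Eb j` (`j ≤ k`), the multiplier form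
`Δ↾Ω₀[D*A + Δλ′ + 𝔑(λ′)] = Q′ᵀμ` on `Ω₀`, and `Restr129 L k Λs U₀ (u₁ · e^{iλ′})`.

HONEST SCOPE.  Assembly over landed modules; every analytic input is a displayed hypothesis named for its source ((1.92), (1.98)–(1.101) = [4];
Sect. E (1.114), [3] Prop. 10); nothing of [4] or Sect. E is proved here.  Count-neutral; N05 NOT discharged; nothing continuum / ℝ⁴ / OS /
mass-gap / Clay.  Unit `pub-ymgap-dag-n19-b` (g2), 2026-08-26.  Tree API by name only, nothing restated.
-/

noncomputable section

open NormedSpace Metric Set Filter Topology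
open Complex (I)

namespace Literature.MathematicalPhysics.QuantumFieldTheory.Balaban1983to89.B8Prop5JoinHFP

open B7Prop1Explicit (e)
open B7Prop2Explicit (unitaryUnits)
open B7Eq78Linearization (conjR)
open B7Eq167Flat (Cond167)
open B8Ineq132 (covDerivFwd covDeriv)
open B8Eq119TwistedAxial (Restr129)
open B8Eq138LandauZd (covLap covDivB QT covLap_zero)
open B8Eq178Averages (util178 Qnl Cond179)
open B8Eq182Proof (gAd)
open B8Eq184Proof (gaugeExp)
open B8Eq188Proof (frakF3 gAd_neg)
open B8LambdaSpaceKLevel (wt lamSubK lamOf norm_le_iff)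
open B8Prop5ContractionKLevel (Bd2 Zsol Vop Wsrc PsiP5 Mc Kc)
open B8Prop5GaugeParamKLevel (gaugeParam_kLevel gpar_size)
open B8Prop5KLevelLetters (multiplier_iff_of_whyZ covLap_sub gAd_sub)
open B8Restr129Inversion (restr129_mul_of_cond179_inv)
open B8Eq195Linear (eq_g_proj325_iff proj325_sub)

-- `Site` alone could resolve to the torus sites of `Setup.lean`; re-export the `ℤ^d` sites of `B7Prop1Explicit`.
export B7Prop1Explicit (Site)

variable {d : ℕ} {𝔸 : Type*} [CStarAlgebra 𝔸] [Nontrivial 𝔸]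

omit [Nontrivial 𝔸] in
/-- `Δ(−f) = −Δf` for the covariant Laplacian. [cite: Balaban1985RegularSpaces, (1.1) p.76] -/
theorem covLap_neg' (η : ℝ) (U₀ : Site d → Fin d → 𝔸ˣ) (f : Site d → 𝔸) (x : Site d) : covLap η U₀ (-f) x = -covLap η U₀ f x := by
  rw [← zero_sub f, covLap_sub, covLap_zero, zero_sub]

variable {L k : ℕ} {η β : ℝ} {Ω Λs : ℕ → Set (Site d)} {Eb : ℕ → Set (Site d × Fin d)} {U₀ : Site d → Fin d → 𝔸ˣ}
  {A : Site d → Fin d → 𝔸} {u₁ : Site d → 𝔸ˣ}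

/-- **PROPOSITION 5'S FIXED POINT IN THE KNIT'S CURRENCY (the binder `hFP` of `B8Prop5KLevelLetters.hP5_step_of_HFP`, modulo letters).**
Letters of [4] as ℂ-linear maps on `E = (Site d → 𝔸)`, `F = (ℕ → Site d → 𝔸)`: `g = G′`, `c = C`, `q = Q′`, `qs = Q′*`, `Aw = a`, `Δ`, with
the projection laws `g_left`/`g_right`/`c_right` (`c_left` is not needed) and the concrete readings on `Ω₀` (`Δf = Δ^η_{U₀}(𝟙_{Ω₀}f)`, `qs μ = Q′ᵀμ`); `R f =
f − G′Q′*CQ′G′f` ((1.95)); the bounds (1.101) of `G′` (`B_G`), (1.98)R (`B_R`), their Dirichlet range and reality; the Sect. E correction `H_c`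
(JOIN-A's displayed sizes/moduli/reality/support); the datum `A` ((1.69)-type sizes, Hermitian, `D*A`'s weighted size); Sect. E's (1.114) on the
ball for the inverse pair `((e^{iλ′})⁻¹, u₁⁻¹)` (`h114`), the domain/(167) inputs of that pair ([3] Prop. 10) and (1.29) for `u₁⁻¹`; the
windows and smallness of the contraction.  CONCLUSION: a gauge parameter `λ′`, Hermitian, `= 0` off `Ω₀`, obeying (1.108) on the `Eb j`, the
multiplier form of the Landau equation on `Ω₀`, and (1.29) at `k` levels for `u₁·e^{iλ′}`.
[cite: Balaban1985RegularSpaces, Prop. 5 (1.107)–(1.109) p.94, (1.95)–(1.100) pp.92–93, (1.113)–(1.114) p.95, (1.78)–(1.79) p.90] -/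
theorem hFP_kLevel (hL : 1 ≤ L) (hη : 0 < η) (hU₀ : ∀ x κ, U₀ x κ ∈ unitaryUnits 𝔸)
    (hEbΩ : ∀ j, j ≤ k → ∀ x ∈ Ω j, ∀ μ : Fin d, (x, μ) ∈ Eb j ∧ (x - e μ, μ) ∈ Eb j)
    -- letters of [4]
    (g Δ : (Site d → 𝔸) →ₗ[ℂ] (Site d → 𝔸)) (q : (Site d → 𝔸) →ₗ[ℂ] (ℕ → Site d → 𝔸)) (qs : (ℕ → Site d → 𝔸) →ₗ[ℂ] (Site d → 𝔸))
    (Aw c : (ℕ → Site d → 𝔸) →ₗ[ℂ] (ℕ → Site d → 𝔸))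
    (g_left : ∀ x, g (Δ x + qs (Aw (q x))) = x) (g_right : ∀ x, Δ (g x) + qs (Aw (q (g x))) = x)
    (c_right : ∀ φ, q (g (g (qs (c φ)))) = φ)
    (hΔ : ∀ (f : Site d → 𝔸), ∀ x ∈ Ω 0, Δ f x = covLap η U₀ ((Ω 0).indicator f) x)
    (hqs : ∀ (μ : ℕ → Site d → 𝔸), ∀ x ∈ Ω 0, qs μ x = QT L k Λs U₀ μ x)
    (Hc : (Site d → 𝔸) → (Site d → 𝔸))
    {α₄ BG BR h₀ h₁ h₂ l₀ l₁ l₂ cA cDA : ℝ}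
    (hα₄ : 0 ≤ α₄) (hBG : 0 ≤ BG) (hBR : 0 ≤ BR) (hh₀ : 0 ≤ h₀) (hh₂ : 0 ≤ h₂) (hl₀ : 0 ≤ l₀) (hl₁ : 0 ≤ l₁)
    (hl₂ : 0 ≤ l₂) (hcA : 0 ≤ cA) (hcA' : cA ≤ 1 / 13) (hcDA : 0 ≤ cDA)
    (ha₁' : α₄ / 4 + h₀ ≤ 1 / 24) (hb₁' : α₄ / 4 + h₁ ≤ 1 / 140) (hb₁ : 0 < α₄ / 4 + h₁) (hθ : 10 * (α₄ / 4 + h₀) * BR ≤ 1 / 2)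
    (hh₀' : h₀ ≤ 3 * α₄ / 4) (hh₁' : h₁ ≤ 3 * α₄ / 4)
    -- (1.101) for G′, (1.98)R, Dirichlet range, reality
    (hG : ∀ (f : Site d → 𝔸) (m : ℝ), 0 ≤ m → Bd2 L η k Ω f m →
      (∀ x, ‖g f x‖ ≤ BG * m) ∧ ∀ j, j ≤ k → ∀ p ∈ Eb j, wt L η j * ‖covDerivFwd η U₀ p.2 (g f) p.1‖ ≤ BG * m)
    (hGsupp : ∀ (f : Site d → 𝔸) (x : Site d), x ∉ Ω 0 → g f x = 0)
    (hGreal : ∀ f : Site d → 𝔸, (∀ j, j ≤ k → ∀ x ∈ Ω j, IsSelfAdjoint (f x)) → ∀ x, IsSelfAdjoint (g f x))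
    (hRbd : ∀ (f : Site d → 𝔸) (m : ℝ), 0 ≤ m → Bd2 L η k Ω f m → Bd2 L η k Ω (f - g (qs (c (q (g f))))) (BR * m))
    (hRreal : ∀ f : Site d → 𝔸, (∀ j, j ≤ k → ∀ x ∈ Ω j, IsSelfAdjoint (f x)) →
      ∀ j, j ≤ k → ∀ x ∈ Ω j, IsSelfAdjoint ((f - g (qs (c (q (g f))))) x))
    -- the Sect. E correction `H_c` (λ′ = λ + H_c λ)
    (hc0 : ∀ s : lamSubK η U₀ L k Eb, ‖s‖ ≤ α₄ / 4 → ∀ x, ‖Hc (lamOf s) x‖ ≤ h₀)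
    (hc1 : ∀ s : lamSubK η U₀ L k Eb, ‖s‖ ≤ α₄ / 4 → ∀ j, j ≤ k → ∀ p ∈ Eb j, wt L η j * ‖covDerivFwd η U₀ p.2 (Hc (lamOf s)) p.1‖ ≤ h₁)
    (hc2 : ∀ s : lamSubK η U₀ L k Eb, ‖s‖ ≤ α₄ / 4 → Bd2 L η k Ω (covLap η U₀ (Hc (lamOf s))) h₂)
    (hcL0 : ∀ s t : lamSubK η U₀ L k Eb, ‖s‖ ≤ α₄ / 4 → ‖t‖ ≤ α₄ / 4 → ∀ x, ‖Hc (lamOf s) x - Hc (lamOf t) x‖ ≤ l₀ * ‖s - t‖)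
    (hcL1 : ∀ s t : lamSubK η U₀ L k Eb, ‖s‖ ≤ α₄ / 4 → ‖t‖ ≤ α₄ / 4 → ∀ j, j ≤ k → ∀ p ∈ Eb j,
      wt L η j * ‖covDerivFwd η U₀ p.2 (Hc (lamOf s) - Hc (lamOf t)) p.1‖ ≤ l₁ * ‖s - t‖)
    (hcL2 : ∀ s t : lamSubK η U₀ L k Eb, ‖s‖ ≤ α₄ / 4 → ‖t‖ ≤ α₄ / 4 →
      Bd2 L η k Ω (covLap η U₀ (Hc (lamOf s)) - covLap η U₀ (Hc (lamOf t))) (l₂ * ‖s - t‖))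
    (hcsa : ∀ s : lamSubK η U₀ L k Eb, ‖s‖ ≤ α₄ / 4 → (∀ x, IsSelfAdjoint (lamOf s x)) → ∀ x, IsSelfAdjoint (Hc (lamOf s) x))
    (hcsupp : ∀ s : lamSubK η U₀ L k Eb, ‖s‖ ≤ α₄ / 4 → ∀ x, x ∉ Ω 0 → Hc (lamOf s) x = 0)
    -- the datum
    (hDA : Bd2 L η k Ω (fun y => covDivB η U₀ A y) cDA) (hDAsa : ∀ j, j ≤ k → ∀ x ∈ Ω j, IsSelfAdjoint (covDivB η U₀ A x))
    (hA : ∀ j, j ≤ k → ∀ x ∈ Ω j, ∀ μ : Fin d,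
      wt L η j * ‖A x μ‖ ≤ cA ∧ wt L η j * ‖conjR (U₀ (x - e μ) μ)⁻¹ (A (x - e μ) μ)‖ ≤ cA)
    (hAsa : ∀ x μ, IsSelfAdjoint (A x μ))
    -- smallness (1.103)/(1.106)
    (h103 : BG * Mc d BR (α₄ / 4 + h₁) cA h₂ cDA ≤ α₄ / 4)
    (h106 : BG * Kc d BR (α₄ / 4 + h₁) cA h₂ cDA l₂ (1 + l₀) (1 + l₁) ≤ 1 / 2)
    -- Sect. E (1.114) for the inverse pair on the ball, the [3] Prop. 10 inputs of that pair, (1.29) for u₁⁻¹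
    (h114 : ∀ s : lamSubK η U₀ L k Eb, ‖s‖ ≤ α₄ / 4 → ∀ j, j ≤ k → ∀ y ∈ Λs j,
      Qnl L U₀ (gaugeExp (lamOf s + Hc (lamOf s)))⁻¹ u₁⁻¹ j y = q (-lamOf s) j y)
    (hdom : ∀ s : lamSubK η U₀ L k Eb, ‖s‖ ≤ α₄ / 4 → ∀ j, j ≤ k → ∀ y ∈ Λs j,
      ‖util178 L U₀ (gaugeExp (lamOf s + Hc (lamOf s)))⁻¹ u₁⁻¹ j y - 1‖ < 1)
    (h167 : ∀ s : lamSubK η U₀ L k Eb, ‖s‖ ≤ α₄ / 4 → Cond167 L U₀ ((gaugeExp (lamOf s + Hc (lamOf s)))⁻¹ * u₁⁻¹) k β η)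
    (h129inv : Restr129 L k Λs U₀ u₁⁻¹) (hβ : 0 ≤ β) (hβs : β * (L : ℝ) ^ k * η < 1 / 2) :
    ∃ lam : Site d → 𝔸, (∀ x, IsSelfAdjoint (lam x)) ∧ (∀ x, x ∉ Ω 0 → lam x = 0) ∧
      (∀ j, j ≤ k → ∀ p ∈ Eb j, ‖lam p.1‖ ≤ α₄ ∧ wt L η j * ‖covDerivFwd η U₀ p.2 lam p.1‖ ≤ α₄) ∧
      (∃ μ : ℕ → Site d → 𝔸, ∀ x ∈ Ω 0,
        covLap η U₀ ((Ω 0).indicator fun y => covDivB η U₀ A y + covLap η U₀ lam y +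
          ((conjR (gaugeExp lam y)⁻¹ (covDivB η U₀ A y) - covDivB η U₀ A y) +
            (gAd (covLap η U₀ lam y) (lam y) - covLap η U₀ lam y) + ∑ μ, frakF3 η U₀ lam A y μ)) x = QT L k Λs U₀ μ x) ∧
      Restr129 L k Λs U₀ (u₁ * gaugeExp lam) := by
  -- the letter R of (1.95)
  set R : (Site d → 𝔸) → (Site d → 𝔸) := fun f => f - g (qs (c (q (g f)))) with hRdef
  have hR : ∀ f, R f = f - g (qs (c (q (g f)))) := fun f => rfl
  have hRsub : ∀ f f' : Site d → 𝔸, R (f - f') = R f - R f' := proj325_sub (R := R) hR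
  have hR0 : R 0 = 0 := by rw [hR]; simp
  have hRneg : ∀ f : Site d → 𝔸, R (-f) = -R f := fun f => by rw [← zero_sub, hRsub, hR0, zero_sub]
  -- JOIN-A
  obtain ⟨s, s', hs, hfix, hs', hn', hsa', hoff', hN⟩ := gaugeParam_kLevel (Ω := Ω) (Eb := Eb) (U₀ := U₀) (A := A)
    (DA := fun y => covDivB η U₀ A y) hL hη hU₀ hEbΩ (⇑g) R Hc hα₄ hBG hBR hh₀ hh₂ hl₀ hl₁ hl₂ hcA hcA' hcDA ha₁' hb₁' hb₁ hθ hh₀' hh₁'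
    hG (fun f f' => map_sub g f f') hGsupp hGreal hRsub hRbd hRreal hc0 hc1 hc2 hcL0 hcL1 hcL2 hcsa hcsupp hDA hDAsa hA hAsa h103 h106
  set lam' := lamOf s' with hlam'def
  have hgp : lamOf s + Hc (lamOf s) = lam' := hs'.symm
  -- the Neumann solution at λ′
  set Z : Site d → 𝔸 := Zsol (Wsrc η U₀ A (fun y => covDivB η U₀ A y) lam' (covLap η U₀ (Hc (lamOf s)))) (Vop lam') R with hZdef
  -- the fixed point read through the projection laws: Q′λ = 0 and Δλ = R(−Z)
  have hfix' : lamOf s = g (R (fun x => -Z x)) := by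
    have h := hfix
    simp only [PsiP5] at h
    rw [hgp] at h
    exact h
  have hfix'' : lamOf s = g (R (-Z)) := hfix'
  obtain ⟨hq, hΔs⟩ := (eq_g_proj325_iff (A := Aw) hR g_left g_right c_right (lamOf s) (-Z)).1 hfix''
  -- sizes at λ′ on Ω₀
  have hl : ∀ y ∈ Ω 0, ‖lam' y‖ ≤ 1 / 12 := fun y _ => by
    rw [← hgp]; exact (gpar_size hc0 s hs y).trans (ha₁'.trans (by norm_num))
  -- support of λ_s (Dirichlet range of G′)
  have hoff : ∀ x, x ∉ Ω 0 → lamOf s x = 0 := fun x hx => by rw [hfix'']; exact hGsupp _ x hx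
  have hind : (Ω 0).indicator (lamOf s) = lamOf s := by
    funext x
    by_cases hx : x ∈ Ω 0
    · rw [Set.indicator_of_mem hx]
    · rw [Set.indicator_of_notMem hx, hoff x hx]
  refine ⟨lam', hsa', hoff', fun j hj p hp => ?_, ?_, ?_⟩
  · -- (1.108)
    have h := (norm_le_iff hη.le s' hα₄).1 hn'
    exact ⟨h.1 p.1, h.2 j hj p hp⟩
  · -- the multiplier clause, via n04-b's WHY-Z bridge
    have hdef : lam' = lamOf s - (-Hc (lamOf s)) := by rw [sub_neg_eq_add, hgp]
    have hNy : ∀ y ∈ Ω 0, Z y + (gAd (R Z y) (lam' y) - R Z y) =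
        conjR (gaugeExp lam' y)⁻¹ (covDivB η U₀ A y) - gAd (covLap η U₀ (-Hc (lamOf s)) y) (lam' y) + ∑ μ, frakF3 η U₀ lam' A y μ := by
      intro y hy
      have h := hN 0 (Nat.zero_le _) y hy
      simp only [Vop, Wsrc] at h
      rw [h, covLap_neg', gAd_neg _ (hl y hy), sub_neg_eq_add]
    have hΔy : ∀ y ∈ Ω 0, covLap η U₀ (lamOf s) y = -R Z y := by
      intro y hy
      rw [← hind, ← hΔ _ y hy, hΔs, hRneg, Pi.neg_apply]
    refine (multiplier_iff_of_whyZ L k (Ω 0) Λs U₀ A hdef hl hNy hΔy).2 ?_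
    -- Z − RZ = G′Q′*φ with φ := CQ′G′Z, and ΔG′Q′*φ = Q′*(φ − aQ′G′Q′*φ)
    set φ := c (q (g Z)) with hφ
    refine ⟨φ - Aw (q (g (qs φ))), fun x hx => ?_⟩
    have hZR : Z - R Z = g (qs φ) := by rw [hR]; abel
    have hlap : Δ (g (qs φ)) = qs (φ - Aw (q (g (qs φ)))) := by
      rw [map_sub]
      exact eq_sub_of_add_eq (g_right (qs φ))
    rw [← hΔ _ x hx, hZR, hlap, hqs _ x hx]
  · -- (1.29) for u₁·e^{iλ′} by INVERSION (a″): Q′λ = 0 ⇒ (1.114) ⇒ Cond179 of the inverse pair ⇒ Restr129 of the composite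
    have hqneg : q (-lamOf s) = 0 := by rw [map_neg, hq, neg_zero]
    have h179 : Cond179 L k Λs U₀ (gaugeExp lam')⁻¹ u₁⁻¹ := by
      intro j hj y hy
      rw [← hgp, h114 s hs j hj y hy, hqneg]
      rfl
    have h := restr129_mul_of_cond179_inv (Λ := Λs) h129inv (by rw [← hgp]; exact hdom s hs) (by rw [← hgp]; exact h167 s hs) hL hη.le hβ
      hβs h179
    exact h


/-- **(v1.1) THE SAME, WITH SECT. E'S (1.114) DISPLAYED IN ITS PRINTED USE** («thus `Q′(u₁, λ′) = 0`», p. 95): instead of the identity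
`h114` (whose right-hand side depends on the `i`-convention of the provider's `Q′`), the hypothesis `h179` asks only that the linear constraint
`Q′λ = 0` on `𝔅_k` imply (1.79) for the inverse pair — the form `B8SectEKLevelDomainSeq.exists_Dprime_kLevel_of_domainSeq`'s last clause
delivers after one rewrite, whatever the scalar convention.  Otherwise verbatim:
**PROPOSITION 5'S FIXED POINT IN THE KNIT'S CURRENCY (the binder `hFP` of `B8Prop5KLevelLetters.hP5_step_of_HFP`, modulo letters).**
Letters of [4] as ℂ-linear maps on `E = (Site d → 𝔸)`, `F = (ℕ → Site d → 𝔸)`: `g = G′`, `c = C`, `q = Q′`, `qs = Q′*`, `Aw = a`, `Δ`, with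
the projection laws `g_left`/`g_right`/`c_right` (`c_left` is not needed) and the concrete readings on `Ω₀` (`Δf = Δ^η_{U₀}(𝟙_{Ω₀}f)`, `qs μ = Q′ᵀμ`); `R f =
f − G′Q′*CQ′G′f` ((1.95)); the bounds (1.101) of `G′` (`B_G`), (1.98)R (`B_R`), their Dirichlet range and reality; the Sect. E correction `H_c`
(JOIN-A's displayed sizes/moduli/reality/support); the datum `A` ((1.69)-type sizes, Hermitian, `D*A`'s weighted size); Sect. E's (1.114) on the
ball for the inverse pair `((e^{iλ′})⁻¹, u₁⁻¹)` in its printed use (`h179`), the domain/(167) inputs of that pair ([3] Prop. 10) and (1.29) for `u₁⁻¹`; the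
windows and smallness of the contraction.  CONCLUSION: a gauge parameter `λ′`, Hermitian, `= 0` off `Ω₀`, obeying (1.108) on the `Eb j`, the
multiplier form of the Landau equation on `Ω₀`, and (1.29) at `k` levels for `u₁·e^{iλ′}`.
[cite: Balaban1985RegularSpaces, Prop. 5 (1.107)–(1.109) p.94, (1.95)–(1.100) pp.92–93, (1.113)–(1.114) p.95, (1.78)–(1.79) p.90] -/
theorem hFP_kLevel_of179 (hL : 1 ≤ L) (hη : 0 < η) (hU₀ : ∀ x κ, U₀ x κ ∈ unitaryUnits 𝔸)
    (hEbΩ : ∀ j, j ≤ k → ∀ x ∈ Ω j, ∀ μ : Fin d, (x, μ) ∈ Eb j ∧ (x - e μ, μ) ∈ Eb j)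
    -- letters of [4]
    (g Δ : (Site d → 𝔸) →ₗ[ℂ] (Site d → 𝔸)) (q : (Site d → 𝔸) →ₗ[ℂ] (ℕ → Site d → 𝔸)) (qs : (ℕ → Site d → 𝔸) →ₗ[ℂ] (Site d → 𝔸))
    (Aw c : (ℕ → Site d → 𝔸) →ₗ[ℂ] (ℕ → Site d → 𝔸))
    (g_left : ∀ x, g (Δ x + qs (Aw (q x))) = x) (g_right : ∀ x, Δ (g x) + qs (Aw (q (g x))) = x)
    (c_right : ∀ φ, q (g (g (qs (c φ)))) = φ)
    (hΔ : ∀ (f : Site d → 𝔸), ∀ x ∈ Ω 0, Δ f x = covLap η U₀ ((Ω 0).indicator f) x)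
    (hqs : ∀ (μ : ℕ → Site d → 𝔸), ∀ x ∈ Ω 0, qs μ x = QT L k Λs U₀ μ x)
    (Hc : (Site d → 𝔸) → (Site d → 𝔸))
    {α₄ BG BR h₀ h₁ h₂ l₀ l₁ l₂ cA cDA : ℝ}
    (hα₄ : 0 ≤ α₄) (hBG : 0 ≤ BG) (hBR : 0 ≤ BR) (hh₀ : 0 ≤ h₀) (hh₂ : 0 ≤ h₂) (hl₀ : 0 ≤ l₀) (hl₁ : 0 ≤ l₁)
    (hl₂ : 0 ≤ l₂) (hcA : 0 ≤ cA) (hcA' : cA ≤ 1 / 13) (hcDA : 0 ≤ cDA)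
    (ha₁' : α₄ / 4 + h₀ ≤ 1 / 24) (hb₁' : α₄ / 4 + h₁ ≤ 1 / 140) (hb₁ : 0 < α₄ / 4 + h₁) (hθ : 10 * (α₄ / 4 + h₀) * BR ≤ 1 / 2)
    (hh₀' : h₀ ≤ 3 * α₄ / 4) (hh₁' : h₁ ≤ 3 * α₄ / 4)
    -- (1.101) for G′, (1.98)R, Dirichlet range, reality
    (hG : ∀ (f : Site d → 𝔸) (m : ℝ), 0 ≤ m → Bd2 L η k Ω f m →
      (∀ x, ‖g f x‖ ≤ BG * m) ∧ ∀ j, j ≤ k → ∀ p ∈ Eb j, wt L η j * ‖covDerivFwd η U₀ p.2 (g f) p.1‖ ≤ BG * m)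
    (hGsupp : ∀ (f : Site d → 𝔸) (x : Site d), x ∉ Ω 0 → g f x = 0)
    (hGreal : ∀ f : Site d → 𝔸, (∀ j, j ≤ k → ∀ x ∈ Ω j, IsSelfAdjoint (f x)) → ∀ x, IsSelfAdjoint (g f x))
    (hRbd : ∀ (f : Site d → 𝔸) (m : ℝ), 0 ≤ m → Bd2 L η k Ω f m → Bd2 L η k Ω (f - g (qs (c (q (g f))))) (BR * m))
    (hRreal : ∀ f : Site d → 𝔸, (∀ j, j ≤ k → ∀ x ∈ Ω j, IsSelfAdjoint (f x)) →
      ∀ j, j ≤ k → ∀ x ∈ Ω j, IsSelfAdjoint ((f - g (qs (c (q (g f))))) x))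
    -- the Sect. E correction `H_c` (λ′ = λ + H_c λ)
    (hc0 : ∀ s : lamSubK η U₀ L k Eb, ‖s‖ ≤ α₄ / 4 → ∀ x, ‖Hc (lamOf s) x‖ ≤ h₀)
    (hc1 : ∀ s : lamSubK η U₀ L k Eb, ‖s‖ ≤ α₄ / 4 → ∀ j, j ≤ k → ∀ p ∈ Eb j, wt L η j * ‖covDerivFwd η U₀ p.2 (Hc (lamOf s)) p.1‖ ≤ h₁)
    (hc2 : ∀ s : lamSubK η U₀ L k Eb, ‖s‖ ≤ α₄ / 4 → Bd2 L η k Ω (covLap η U₀ (Hc (lamOf s))) h₂)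
    (hcL0 : ∀ s t : lamSubK η U₀ L k Eb, ‖s‖ ≤ α₄ / 4 → ‖t‖ ≤ α₄ / 4 → ∀ x, ‖Hc (lamOf s) x - Hc (lamOf t) x‖ ≤ l₀ * ‖s - t‖)
    (hcL1 : ∀ s t : lamSubK η U₀ L k Eb, ‖s‖ ≤ α₄ / 4 → ‖t‖ ≤ α₄ / 4 → ∀ j, j ≤ k → ∀ p ∈ Eb j,
      wt L η j * ‖covDerivFwd η U₀ p.2 (Hc (lamOf s) - Hc (lamOf t)) p.1‖ ≤ l₁ * ‖s - t‖)
    (hcL2 : ∀ s t : lamSubK η U₀ L k Eb, ‖s‖ ≤ α₄ / 4 → ‖t‖ ≤ α₄ / 4 →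
      Bd2 L η k Ω (covLap η U₀ (Hc (lamOf s)) - covLap η U₀ (Hc (lamOf t))) (l₂ * ‖s - t‖))
    (hcsa : ∀ s : lamSubK η U₀ L k Eb, ‖s‖ ≤ α₄ / 4 → (∀ x, IsSelfAdjoint (lamOf s x)) → ∀ x, IsSelfAdjoint (Hc (lamOf s) x))
    (hcsupp : ∀ s : lamSubK η U₀ L k Eb, ‖s‖ ≤ α₄ / 4 → ∀ x, x ∉ Ω 0 → Hc (lamOf s) x = 0)
    -- the datum
    (hDA : Bd2 L η k Ω (fun y => covDivB η U₀ A y) cDA) (hDAsa : ∀ j, j ≤ k → ∀ x ∈ Ω j, IsSelfAdjoint (covDivB η U₀ A x))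
    (hA : ∀ j, j ≤ k → ∀ x ∈ Ω j, ∀ μ : Fin d,
      wt L η j * ‖A x μ‖ ≤ cA ∧ wt L η j * ‖conjR (U₀ (x - e μ) μ)⁻¹ (A (x - e μ) μ)‖ ≤ cA)
    (hAsa : ∀ x μ, IsSelfAdjoint (A x μ))
    -- smallness (1.103)/(1.106)
    (h103 : BG * Mc d BR (α₄ / 4 + h₁) cA h₂ cDA ≤ α₄ / 4)
    (h106 : BG * Kc d BR (α₄ / 4 + h₁) cA h₂ cDA l₂ (1 + l₀) (1 + l₁) ≤ 1 / 2)
    -- Sect. E (1.114) for the inverse pair on the ball, the [3] Prop. 10 inputs of that pair, (1.29) for u₁⁻¹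
    (h179 : ∀ s : lamSubK η U₀ L k Eb, ‖s‖ ≤ α₄ / 4 → q (lamOf s) = 0 →
      Cond179 L k Λs U₀ (gaugeExp (lamOf s + Hc (lamOf s)))⁻¹ u₁⁻¹)
    (hdom : ∀ s : lamSubK η U₀ L k Eb, ‖s‖ ≤ α₄ / 4 → ∀ j, j ≤ k → ∀ y ∈ Λs j,
      ‖util178 L U₀ (gaugeExp (lamOf s + Hc (lamOf s)))⁻¹ u₁⁻¹ j y - 1‖ < 1)
    (h167 : ∀ s : lamSubK η U₀ L k Eb, ‖s‖ ≤ α₄ / 4 → Cond167 L U₀ ((gaugeExp (lamOf s + Hc (lamOf s)))⁻¹ * u₁⁻¹) k β η)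
    (h129inv : Restr129 L k Λs U₀ u₁⁻¹) (hβ : 0 ≤ β) (hβs : β * (L : ℝ) ^ k * η < 1 / 2) :
    ∃ lam : Site d → 𝔸, (∀ x, IsSelfAdjoint (lam x)) ∧ (∀ x, x ∉ Ω 0 → lam x = 0) ∧
      (∀ j, j ≤ k → ∀ p ∈ Eb j, ‖lam p.1‖ ≤ α₄ ∧ wt L η j * ‖covDerivFwd η U₀ p.2 lam p.1‖ ≤ α₄) ∧
      (∃ μ : ℕ → Site d → 𝔸, ∀ x ∈ Ω 0,
        covLap η U₀ ((Ω 0).indicator fun y => covDivB η U₀ A y + covLap η U₀ lam y +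
          ((conjR (gaugeExp lam y)⁻¹ (covDivB η U₀ A y) - covDivB η U₀ A y) +
            (gAd (covLap η U₀ lam y) (lam y) - covLap η U₀ lam y) + ∑ μ, frakF3 η U₀ lam A y μ)) x = QT L k Λs U₀ μ x) ∧
      Restr129 L k Λs U₀ (u₁ * gaugeExp lam) := by
  -- the letter R of (1.95)
  set R : (Site d → 𝔸) → (Site d → 𝔸) := fun f => f - g (qs (c (q (g f)))) with hRdef
  have hR : ∀ f, R f = f - g (qs (c (q (g f)))) := fun f => rfl
  have hRsub : ∀ f f' : Site d → 𝔸, R (f - f') = R f - R f' := proj325_sub (R := R) hR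
  have hR0 : R 0 = 0 := by rw [hR]; simp
  have hRneg : ∀ f : Site d → 𝔸, R (-f) = -R f := fun f => by rw [← zero_sub, hRsub, hR0, zero_sub]
  -- JOIN-A
  obtain ⟨s, s', hs, hfix, hs', hn', hsa', hoff', hN⟩ := gaugeParam_kLevel (Ω := Ω) (Eb := Eb) (U₀ := U₀) (A := A)
    (DA := fun y => covDivB η U₀ A y) hL hη hU₀ hEbΩ (⇑g) R Hc hα₄ hBG hBR hh₀ hh₂ hl₀ hl₁ hl₂ hcA hcA' hcDA ha₁' hb₁' hb₁ hθ hh₀' hh₁'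
    hG (fun f f' => map_sub g f f') hGsupp hGreal hRsub hRbd hRreal hc0 hc1 hc2 hcL0 hcL1 hcL2 hcsa hcsupp hDA hDAsa hA hAsa h103 h106
  set lam' := lamOf s' with hlam'def
  have hgp : lamOf s + Hc (lamOf s) = lam' := hs'.symm
  -- the Neumann solution at λ′
  set Z : Site d → 𝔸 := Zsol (Wsrc η U₀ A (fun y => covDivB η U₀ A y) lam' (covLap η U₀ (Hc (lamOf s)))) (Vop lam') R with hZdef
  -- the fixed point read through the projection laws: Q′λ = 0 and Δλ = R(−Z)
  have hfix' : lamOf s = g (R (fun x => -Z x)) := by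
    have h := hfix
    simp only [PsiP5] at h
    rw [hgp] at h
    exact h
  have hfix'' : lamOf s = g (R (-Z)) := hfix'
  obtain ⟨hq, hΔs⟩ := (eq_g_proj325_iff (A := Aw) hR g_left g_right c_right (lamOf s) (-Z)).1 hfix''
  -- sizes at λ′ on Ω₀
  have hl : ∀ y ∈ Ω 0, ‖lam' y‖ ≤ 1 / 12 := fun y _ => by
    rw [← hgp]; exact (gpar_size hc0 s hs y).trans (ha₁'.trans (by norm_num))
  -- support of λ_s (Dirichlet range of G′)
  have hoff : ∀ x, x ∉ Ω 0 → lamOf s x = 0 := fun x hx => by rw [hfix'']; exact hGsupp _ x hx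
  have hind : (Ω 0).indicator (lamOf s) = lamOf s := by
    funext x
    by_cases hx : x ∈ Ω 0
    · rw [Set.indicator_of_mem hx]
    · rw [Set.indicator_of_notMem hx, hoff x hx]
  refine ⟨lam', hsa', hoff', fun j hj p hp => ?_, ?_, ?_⟩
  · -- (1.108)
    have h := (norm_le_iff hη.le s' hα₄).1 hn'
    exact ⟨h.1 p.1, h.2 j hj p hp⟩
  · -- the multiplier clause, via n04-b's WHY-Z bridge
    have hdef : lam' = lamOf s - (-Hc (lamOf s)) := by rw [sub_neg_eq_add, hgp]
    have hNy : ∀ y ∈ Ω 0, Z y + (gAd (R Z y) (lam' y) - R Z y) =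
        conjR (gaugeExp lam' y)⁻¹ (covDivB η U₀ A y) - gAd (covLap η U₀ (-Hc (lamOf s)) y) (lam' y) + ∑ μ, frakF3 η U₀ lam' A y μ := by
      intro y hy
      have h := hN 0 (Nat.zero_le _) y hy
      simp only [Vop, Wsrc] at h
      rw [h, covLap_neg', gAd_neg _ (hl y hy), sub_neg_eq_add]
    have hΔy : ∀ y ∈ Ω 0, covLap η U₀ (lamOf s) y = -R Z y := by
      intro y hy
      rw [← hind, ← hΔ _ y hy, hΔs, hRneg, Pi.neg_apply]
    refine (multiplier_iff_of_whyZ L k (Ω 0) Λs U₀ A hdef hl hNy hΔy).2 ?_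
    -- Z − RZ = G′Q′*φ with φ := CQ′G′Z, and ΔG′Q′*φ = Q′*(φ − aQ′G′Q′*φ)
    set φ := c (q (g Z)) with hφ
    refine ⟨φ - Aw (q (g (qs φ))), fun x hx => ?_⟩
    have hZR : Z - R Z = g (qs φ) := by rw [hR]; abel
    have hlap : Δ (g (qs φ)) = qs (φ - Aw (q (g (qs φ)))) := by
      rw [map_sub]
      exact eq_sub_of_add_eq (g_right (qs φ))
    rw [← hΔ _ x hx, hZR, hlap, hqs _ x hx]
  · -- (1.29) for u₁·e^{iλ′} by INVERSION (a″): Q′λ = 0 ⇒ (1.114) ⇒ Cond179 of the inverse pair ⇒ Restr129 of the composite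
    have h179' : Cond179 L k Λs U₀ (gaugeExp lam')⁻¹ u₁⁻¹ := by rw [← hgp]; exact h179 s hs hq
    have h := restr129_mul_of_cond179_inv (Λ := Λs) h129inv (by rw [← hgp]; exact hdom s hs) (by rw [← hgp]; exact h167 s hs) hL hη.le hβ
      hβs h179'
    exact h

#print axioms hFP_kLevel
#print axioms hFP_kLevel_of179

end Literature.MathematicalPhysics.QuantumFieldTheory.Balaban1983to89.B8Prop5JoinHFP

end
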